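import Summits.AnomalousDissipation.AnomalousDissipation.Theorems.SolenoidalFractalHomogenisationLagrangianStepSidebandXEnergyDefs
import HarnessLib

/-!
# K1L_D `LagrangianRenormalisationStepDesign` (stmt-AnomalousDissipation-27980), `stub_D1_V0` (V0 = clause (ii) of
# `WCrossing.D1ExactFamily`), brick T5: THE SLOW EQUATION IN FORCED FORM — its perturbation operator, its period mean and its forcing
# (shared definitions; reviewed; `--kind definition --supports stmt-AnomalousDissipation-27980 --as helper`)

Summits-side DEFINITIONS file of route `SolenoidalFractalHomogenisation` (prover seat `ad-k1l-cellLawV-w1` g7), the objects of brick T5 of the V0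
memo `Cruxes/LagrangianRenormalisationStepDesign/Lines/onelevel-V0-residual.md` §4: with `Z = r + projX y` (`…SidebandXEnergyDefs`) the slow equation
`…SidebandXChain.hasDerivAt_slowRep` reads `x' = −(4π²P_ℓT_{𝔹ᵀ}(ℓ) x + slowPert t x) + slowForcing t` (`…SidebandXSlowEquation`), a FORCED linear
equation with a `P`-periodic perturbation of period mean `slowMean` (the shape consumed by `Literature.Analysis.ODE.PeriodicAveraging.norm_sub_exp_apply_le_forced`).
Everything is ℝ-linear on `ℂ³` (the reference responses `Nⱼ = responseExt W₁ 𝔸 1 R j` are ℝ-linear):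
* `slowPert W₁ n ℓ 𝔸 R t = Σ_{j j'} (ξⱼ ξ_{j'}) • P_ℓ ∘ feedbackⱼ(t) ∘ N_{j'}(t)` : `ℂ³ →L[ℝ] ℂ³`;
* `slowMean W₁ n ℓ 𝔸 R = Σ_{j j'} (ξⱼ ξ_{j'}) • P_ℓ ∘ M_{jj'}` (`M = meanFeedback W₁ 𝔸 1 R`): the period mean of `slowPert`;
* `slowForcing W₁ n ℓ 𝔸 R F w t = −Σⱼ ξⱼ • P_ℓ feedbackⱼ(t) (r t + (projX (y t) − y t))` : the forcing (residual + projection mismatch, both `O(ξ)`-small).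
Definitions with bodies and unfolding lemmas only; no theorem of substance, no named fact, no sorry.  NOT a proof of anything; rung F-D1.A0
infrastructure.  AD is not proved.
-/

set_option linter.dupNamespace false

noncomputable section

namespace Summit.AnomalousDissipation.AnomalousDissipation.Theorems.SolenoidalFractalHomogenisation.LagrangianStep.Sideband

open Set MeasureTheory Complex UnitAddTorus
open scoped InnerProductSpace
open Literature.Analysis Literature.Analysis.FunctionSpaces Literature.Analysis.FunctionSpaces.Torus
open Literature.Analysis.FluidPDE Literature.Analysis.FluidPDE.Torus Literature.Analysis.FluidPDE.LatticeShear
open Summit.AnomalousDissipation.AnomalousDissipation.Theorems.SolenoidalFractalHomogenisation.LagrangianStep.CellChain (modeRep)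

variable {k₀ : ℕ}

/-! ## §1 The perturbation operator and its period mean -/

/-- **The slow perturbation operator** `slowPert t = Σ_{j j'} (ξⱼ ξ_{j'}) • P_ℓ ∘ feedbackⱼ(t) ∘ N_{j'}(t)` (ℝ-linear on `ℂ³`; `P`-periodic, continuous,
size `O(ξ²/ν)`). [cite: MajdaKramer1999, §2.2.1.3 (55) (effective diffusivity as a cell average)] [cite: SandersVerhulstMurdock2007, Theorem 2.8.1] -/
def slowPert (W₁ : LatticeWord k₀) (n : ℕ) (ℓ : Fin 3 → ℤ) (𝔸 : Torus.Visc4 (Fin 3)) (R : ℕ) (t : ℝ) :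
    EuclideanSpace ℂ (Fin 3) →L[ℝ] EuclideanSpace ℂ (Fin 3) :=
  ∑ j, ∑ j', (xiCoeff W₁ n ℓ j * xiCoeff W₁ n ℓ j') •
    (((transversalProj ℓ).comp (feedback W₁ R j t)).restrictScalars ℝ).comp (responseExt W₁ 𝔸 1 R j' t)

/-- Unfolding `slowPert`. [cite: MajdaKramer1999, §2.2.1.3 (55)] -/
theorem slowPert_def (W₁ : LatticeWord k₀) (n : ℕ) (ℓ : Fin 3 → ℤ) (𝔸 : Torus.Visc4 (Fin 3)) (R : ℕ) (t : ℝ) :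
    slowPert W₁ n ℓ 𝔸 R t = ∑ j, ∑ j', (xiCoeff W₁ n ℓ j * xiCoeff W₁ n ℓ j') •
      (((transversalProj ℓ).comp (feedback W₁ R j t)).restrictScalars ℝ).comp (responseExt W₁ 𝔸 1 R j' t) := rfl

/-- `slowPert` applied to a vector. [cite: MajdaKramer1999, §2.2.1.3 (55)] -/
theorem slowPert_apply (W₁ : LatticeWord k₀) (n : ℕ) (ℓ : Fin 3 → ℤ) (𝔸 : Torus.Visc4 (Fin 3)) (R : ℕ) (t : ℝ) (v : EuclideanSpace ℂ (Fin 3)) :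
    slowPert W₁ n ℓ 𝔸 R t v = ∑ j, ∑ j', (xiCoeff W₁ n ℓ j * xiCoeff W₁ n ℓ j') •
      transversalProj ℓ (feedback W₁ R j t (responseExt W₁ 𝔸 1 R j' t v)) := by
  simp only [slowPert, FunLike.coe_sum, Finset.sum_apply, FunLike.coe_smul, Pi.smul_apply, ContinuousLinearMap.comp_apply,
    ContinuousLinearMap.coe_restrictScalars']

/-- **The period mean of the slow perturbation** `slowMean = Σ_{j j'} (ξⱼ ξ_{j'}) • P_ℓ ∘ M_{jj'}`, `M_{jj'} = meanFeedback W₁ 𝔸 1 R j j'`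
(the slow generator of the `(1/ν)•psiStar` enhancement at `ℓ`, up to the right projection). [cite: MajdaKramer1999, §2.2.1.3 (55)] -/
def slowMean (W₁ : LatticeWord k₀) (n : ℕ) (ℓ : Fin 3 → ℤ) (𝔸 : Torus.Visc4 (Fin 3)) (R : ℕ) :
    EuclideanSpace ℂ (Fin 3) →L[ℝ] EuclideanSpace ℂ (Fin 3) :=
  ∑ j, ∑ j', (xiCoeff W₁ n ℓ j * xiCoeff W₁ n ℓ j') • ((transversalProj ℓ).restrictScalars ℝ).comp (meanFeedback W₁ 𝔸 1 R j j')

/-- Unfolding `slowMean`. [cite: MajdaKramer1999, §2.2.1.3 (55)] -/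
theorem slowMean_def (W₁ : LatticeWord k₀) (n : ℕ) (ℓ : Fin 3 → ℤ) (𝔸 : Torus.Visc4 (Fin 3)) (R : ℕ) :
    slowMean W₁ n ℓ 𝔸 R =
      ∑ j, ∑ j', (xiCoeff W₁ n ℓ j * xiCoeff W₁ n ℓ j') • ((transversalProj ℓ).restrictScalars ℝ).comp (meanFeedback W₁ 𝔸 1 R j j') := rfl

/-- `slowMean` applied to a vector. [cite: MajdaKramer1999, §2.2.1.3 (55)] -/
theorem slowMean_apply (W₁ : LatticeWord k₀) (n : ℕ) (ℓ : Fin 3 → ℤ) (𝔸 : Torus.Visc4 (Fin 3)) (R : ℕ) (v : EuclideanSpace ℂ (Fin 3)) :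
    slowMean W₁ n ℓ 𝔸 R v = ∑ j, ∑ j', (xiCoeff W₁ n ℓ j * xiCoeff W₁ n ℓ j') • transversalProj ℓ (meanFeedback W₁ 𝔸 1 R j j' v) := by
  simp only [slowMean, FunLike.coe_sum, Finset.sum_apply, FunLike.coe_smul, Pi.smul_apply, ContinuousLinearMap.comp_apply,
    ContinuousLinearMap.coe_restrictScalars']

/-! ## §2 The forcing -/

/-- **The forcing of the slow equation** `slowForcing t = −Σⱼ ξⱼ • P_ℓ feedbackⱼ(t) (r t + (projX (y t) − y t))` (`r = residualX`, `y = refState`).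
[cite: MajdaKramer1999, §2.2.1.3 (55)] [cite: SandersVerhulstMurdock2007, Theorem 2.8.1] -/
def slowForcing (W₁ : LatticeWord k₀) (n : ℕ) (ℓ : Fin 3 → ℤ) (𝔸 : Torus.Visc4 (Fin 3)) (R : ℕ)
    (F : UnitAddTorus (Fin 3) → EuclideanSpace ℝ (Fin 3)) (w : ℝ → UnitAddTorus (Fin 3) → EuclideanSpace ℝ (Fin 3)) (t : ℝ) :
    EuclideanSpace ℂ (Fin 3) :=
  -∑ j, ((xiCoeff W₁ n ℓ j : ℝ) : ℂ) • transversalProj ℓ (feedback W₁ R j t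
    (residualX W₁ n ℓ 𝔸 R F w t + (projX n ℓ R (refState W₁ n ℓ 𝔸 R F w t) - refState W₁ n ℓ 𝔸 R F w t)))

/-- Unfolding `slowForcing`. [cite: MajdaKramer1999, §2.2.1.3 (55)] -/
theorem slowForcing_def (W₁ : LatticeWord k₀) (n : ℕ) (ℓ : Fin 3 → ℤ) (𝔸 : Torus.Visc4 (Fin 3)) (R : ℕ)
    (F : UnitAddTorus (Fin 3) → EuclideanSpace ℝ (Fin 3)) (w : ℝ → UnitAddTorus (Fin 3) → EuclideanSpace ℝ (Fin 3)) (t : ℝ) :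
    slowForcing W₁ n ℓ 𝔸 R F w t = -∑ j, ((xiCoeff W₁ n ℓ j : ℝ) : ℂ) • transversalProj ℓ (feedback W₁ R j t
      (residualX W₁ n ℓ 𝔸 R F w t + (projX n ℓ R (refState W₁ n ℓ 𝔸 R F w t) - refState W₁ n ℓ 𝔸 R F w t))) := rfl

end Summit.AnomalousDissipation.AnomalousDissipation.Theorems.SolenoidalFractalHomogenisation.LagrangianStep.Sideband

end
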